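import Literature.Probability.RandomPlanarGeometry.LatticeSlitIncrements
import Literature.Probability.RandomPlanarGeometry.HullHeightBound
import HarnessLib

/-!
# Height and capacity of the hull of a lattice past: capped pasts stay away from interior points

Topic `Literature/Probability/RandomPlanarGeometry`; a companion of `LatticeSlitIncrements.lean`
(the half-plane Loewner coordinates `pastHull`, `capTime = hcap(K_η)/2`, `drivingValue` of a lattice
path `η` of the discrete domain `Ω_δ` of a Dobrushin domain `(D; a, b)` pulled back by a conformal
map `φ : ℍ → D`) and `HullHeightBound.lean` (Kemppainen–Smirnov's height bound
`(im z)² ≤ 2 hcap(K)` for bounded hulls, `im_sq_le_two_mul_hcap_hpFill`).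

For a walk whose polyline stays inside `D`:

* `LatticeSlit.capTime_pos` — **`t_η > 0`**: the hull contains the base point `z₀ = φ⁻¹(δ a) ∈ ℍ`,
  and a hull meeting `ℍ` has positive half-plane capacity (Lawler (2005), (3.8): "if `A ∈ 𝒬`,
  `hcap(A) > 0`", `IsHydrodynamicMap.hcap_pos`);
* `LatticeSlit.im_sq_le_four_mul_capTime` — **`(im z)² ≤ 4 t_η` for every point `z` of the
  generating set `S_η`** (stem and pulled-back trace), i.e. `(im z)² ≤ 2 hcap(K_η)`: Lawler (2005),
  Thm. 4.6 / Kemppainen–Smirnov (2017), App. A, Lemma A.13 ("if `K ∩ (ℝ × {hi}) ≠ ∅` then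
  `hcap(K) ≥ h²/4`" in their normalisation);
* `LatticeSlit.im_symm_sq_le_four_mul_capTime` — in particular for the pull-back `φ⁻¹(δ v)` of every
  vertex `v` of `η`;
* `LatticeSlit.exists_radius_forall_le_dist` — **capped pasts stay away from interior points**: for
  `w ∈ ℍ` there is `ρ = ρ(φ, w) > 0` such that every walk inside `D` with `t_η ≤ (Im w)²/16` keeps all
  its vertices at distance `≥ ρ` from `φ(w)` (a vertex within `ρ` would pull back into the ball
  `B(w, Im w/2)`, above height `Im w/2`, contradicting `(im)² ≤ 4 t_η ≤ (Im w)²/4`). This is the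
  geometric input turning "capacity `≤ (Im w)²/16`" into "the past is `ρ`-far from the observation
  point" in the room–entropy line of the SAW summit (Chelkak–Duminil-Copin–Hongler–Kemppainen–Smirnov
  use the same device with `T(iy) = y²/9`).

## References

* G. F. Lawler, *Conformally Invariant Processes in the Plane*, AMS (2005), §3.4 (3.8), §4.1
  Thm. 4.6 [Lawler2005].
* A. Kemppainen, S. Smirnov, *Random curves, scaling limits and Loewner evolutions*, Ann. Probab. 45
  (2017), App. A, Lemmas A.12–A.13 [KemppainenSmirnov2017].
-/

noncomputable section

open Set Filter Topology Metric Bornology Complex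
open UpperHalfPlane (upperHalfPlaneSet isOpen_upperHalfPlaneSet)
open Literature.Probability.LatticeModels (meshPoint discreteDomainGraph Site)

namespace Literature.Probability.RandomPlanarGeometry

namespace LatticeSlit

variable {D : DobrushinDomain} {φ : ConformalEquiv upperHalfPlaneSet D.carrier} {δ : ℝ}
  {a w : Site 2}

/-- `2 t_η = hcap(K_η)` computed with the chosen hydrodynamic map of the (bounded) hull of a walk
inside `D`. [cite: Lawler2005, §4.1 Remark 4.5 with §3.4 Def. 3.37] -/
theorem two_mul_capTime_eq_hcap (η : (discreteDomainGraph D.carrier δ).Walk a w)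
    (hη : range (η.toCurve (meshPoint δ)) ⊆ D.carrier) :
    2 * capTime φ η = hcap (pastHull φ η) (hydroEquiv (pastHull φ η) (hasHydroMap_pastHull η hη)) := by
  rw [two_mul_capTime, hcapOf_of_hasHydroMap (hasHydroMap_pastHull η hη)]

/-- **`(im z)² ≤ 4 t_η` on the generating set**: every point `z ∈ S_η` (stem or pulled-back trace)
of the past of a walk inside `D` with `im z > 0` has `(im z)² ≤ 2 hcap(K_η) = 4 t_η`
(Kemppainen–Smirnov's height bound for the fill of a closed bounded set attached to `ℝ`).
[cite: KemppainenSmirnov2017, App. A Lemma A.13] -/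
theorem im_sq_le_four_mul_capTime (η : (discreteDomainGraph D.carrier δ).Walk a w)
    (hη : range (η.toCurve (meshPoint δ)) ⊆ D.carrier) {z : ℂ} (hz : z ∈ pastSet φ η)
    (hzi : 0 < z.im) : z.im ^ 2 ≤ 4 * capTime φ η := by
  obtain ⟨hcl, hbd, hconn⟩ := pastSet_attached (φ := φ) η hη
  have h := im_sq_le_two_mul_hcap_hpFill hcl hbd hconn hz hzi
    (isHydrodynamicMap_hydroEquiv (hasHydroMap_pastHull (φ := φ) η hη))
  have h2 := two_mul_capTime_eq_hcap (φ := φ) η hη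
  change z.im ^ 2 ≤ 2 * hcap (pastHull φ η) _ at h
  linarith

/-- The pull-back `φ⁻¹(δ v)` of a vertex `v` of a walk inside `D` lies on the trace. [folklore] -/
theorem symm_meshPoint_mem_trace (η : (discreteDomainGraph D.carrier δ).Walk a w)
    (hη : range (η.toCurve (meshPoint δ)) ⊆ D.carrier) {v : Site 2} (hv : v ∈ η.support) :
    φ.symm (meshPoint δ v) ∈ trace φ η := by
  have hmem : meshPoint δ v ∈ range (η.toCurve (meshPoint δ)) :=
    SimpleGraph.Walk.mem_range_toCurve (meshPoint δ) η hv
  exact ⟨meshPoint δ v, ⟨hmem, hη hmem⟩, rfl⟩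

/-- The pull-back of a vertex of a walk inside `D` is a point of `ℍ`. [folklore] -/
theorem symm_meshPoint_mem_upperHalfPlaneSet (η : (discreteDomainGraph D.carrier δ).Walk a w)
    (hη : range (η.toCurve (meshPoint δ)) ⊆ D.carrier) {v : Site 2} (hv : v ∈ η.support) :
    φ.symm (meshPoint δ v) ∈ upperHalfPlaneSet :=
  φ.symm_mapsTo (hη (SimpleGraph.Walk.mem_range_toCurve (meshPoint δ) η hv))

/-- **`(im φ⁻¹(δ v))² ≤ 4 t_η` for every vertex `v`** of a walk inside `D`.
[cite: KemppainenSmirnov2017, App. A Lemma A.13] -/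
theorem im_symm_sq_le_four_mul_capTime (η : (discreteDomainGraph D.carrier δ).Walk a w)
    (hη : range (η.toCurve (meshPoint δ)) ⊆ D.carrier) {v : Site 2} (hv : v ∈ η.support) :
    (φ.symm (meshPoint δ v)).im ^ 2 ≤ 4 * capTime φ η :=
  im_sq_le_four_mul_capTime η hη
    (subset_closure (Or.inr (symm_meshPoint_mem_trace (φ := φ) η hη hv)))
    (symm_meshPoint_mem_upperHalfPlaneSet (φ := φ) η hη hv)

/-- **`t_η > 0`** for a walk inside `D`: its hull contains the base point `z₀ ∈ ℍ`, and a bounded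
hull meeting `ℍ` has positive half-plane capacity (Lawler (2005), (3.8)). [cite: Lawler2005, §3.4 (3.8)] -/
theorem capTime_pos (η : (discreteDomainGraph D.carrier δ).Walk a w)
    (hη : range (η.toCurve (meshPoint δ)) ⊆ D.carrier) : 0 < capTime φ η := by
  have hK := isBoundedHull_pastHull (φ := φ) η hη
  have hb : IsBounded (pastHull φ η ∩ upperHalfPlaneSet) := hK.1.subset inter_subset_left
  have hz₀ : basePt φ δ a ∈ pastHull φ η ∩ upperHalfPlaneSet := by
    refine ⟨inter_subset_hpFill _ ⟨?_, basePt_mem η hη⟩, basePt_mem η hη⟩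
    exact subset_closure (Or.inl (self_mem_stemArc _))
  have hpos := (isHydrodynamicMap_hydroEquiv (hasHydroMap_pastHull (φ := φ) η hη)).hcap_pos hb
    ⟨_, hz₀⟩
  have h2 := two_mul_capTime_eq_hcap (φ := φ) η hη
  linarith

/-- **Capped pasts stay away from interior points.** For `w ∈ ℍ` there is `ρ > 0` (depending only
on `φ` and `w`) such that every walk of `Ω_δ` inside `D` whose past has capacity time
`t_η ≤ (Im w)²/16` keeps all its vertices at distance `≥ ρ` from `φ(w)`: a vertex within `ρ` of
`φ(w)` would pull back into `B(w, Im w/2)`, at height `> Im w/2`, contradicting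
`(im)² ≤ 4 t_η ≤ (Im w)²/4`. [cite: KemppainenSmirnov2017, App. A Lemma A.13] -/
theorem exists_radius_forall_le_dist (φ : ConformalEquiv upperHalfPlaneSet D.carrier) {w : ℂ}
    (hw : 0 < w.im) :
    ∃ ρ : ℝ, 0 < ρ ∧ ∀ {δ : ℝ} {a w' : Site 2} (η : (discreteDomainGraph D.carrier δ).Walk a w'),
      range (η.toCurve (meshPoint δ)) ⊆ D.carrier → capTime φ η ≤ w.im ^ 2 / 16 →
      ∀ v ∈ η.support, ρ ≤ dist (meshPoint δ v) (φ w) := by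
  have hwH : w ∈ upperHalfPlaneSet := hw
  have hφw : φ w ∈ D.carrier := φ.mapsTo hwH
  -- continuity of `φ⁻¹` at `φ w` (the carrier is open)
  have hcont : ContinuousAt φ.symm (φ w) :=
    (φ.symm.continuousOn (φ w) hφw).continuousAt (D.isOpen.mem_nhds hφw)
  have hball : ∀ᶠ p in 𝓝 (φ w), dist (φ.symm p) (φ.symm (φ w)) < w.im / 2 :=
    hcont (ball_mem_nhds _ (by positivity))
  obtain ⟨ρ, hρ, hρball⟩ := Metric.eventually_nhds_iff.1 hball
  refine ⟨ρ, hρ, fun {δ a w'} η hη hcap v hv ↦ ?_⟩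
  by_contra hlt
  have hdist : dist (meshPoint δ v) (φ w) < ρ := lt_of_not_ge hlt
  have h1 := hρball hdist
  rw [φ.symm_apply_apply hwH] at h1
  -- the pulled-back vertex is high …
  have him : w.im / 2 < (φ.symm (meshPoint δ v)).im := by
    have h2 : |(φ.symm (meshPoint δ v) - w).im| ≤ ‖φ.symm (meshPoint δ v) - w‖ := abs_im_le_norm _
    rw [dist_eq_norm] at h1
    have h3 : -(w.im / 2) < (φ.symm (meshPoint δ v) - w).im := by
      have := neg_abs_le (φ.symm (meshPoint δ v) - w).im
      linarith
    rw [sub_im] at h3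
    linarith
  -- … but the capacity bound keeps it low
  have hle := im_symm_sq_le_four_mul_capTime (φ := φ) η hη hv
  nlinarith [him, hle, hcap, hw]

end LatticeSlit

end Literature.Probability.RandomPlanarGeometry

end
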